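/-
Copyright: the b2b-balaban cell (near-miss cell 7), T⁴-continuum fan-out, lineage t4-ne7b-p3 (node U5c LARGE-DEVIATION
member P3).  Released under the licence of the surrounding project.
-/
import Summits.QuantumFields.BalabanUV.T4Continuum.Support.SpaceTimeTagged

/-!
# Space-time Peierls ∕ Cramér route for NE7b — SANITY, DECIDED: histories EXCLUDED by `TypeNodup` (two joins at one
# step; the row owner's own `twin`) have FRESH, WELL-FORMED tagged labels

Summits-side support leaf of the T⁴-continuum cell (rung (B)+1 on a FINITE torus only; NOT infinite volume, NOT the
mass gap, NOT the Clay statement; NOT a proof of the spine estimate NE7b).  Lineage `t4-ne7b-p3` (generation 3), node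
U5c, skeleton `t4/skeletons/NE7b-t4-ne7b-p3.md` §14 (the TAGGED road).  [folklore] sanity over `SpaceTimeTagged`
(`toGenT`, `freshT_toGenT`, `gmap_snd_toGenT`) and the COUNT swarm's `HistoryAdmissible` (`PGen`, `TypeNodup`,
`not_wf_toGen`, its decided `Sanity.twin`); nothing printed is asserted; no `[cite:]` tag.

WHAT.  `threeWay` = three regions joined at ONE step by two binary joins (print's binarised multi-join, p. 386): it is
NOT `TypeNodup` (decided) — so its canonical label has no well-formed reading for ANY window table
(`HistoryAdmissible.PGen.not_wf_toGen`) — while its tagged label `toGenT 0 threeWay` is fresh (`freshT_toGenT`) and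
reads back to the canonical label under `Prod.snd`; the same for the owner's `twin` (two equal-class regions born at
one step).  So the tagged road admits exactly the histories the flat carrier's ruling R-A excludes.

HONEST DEPENDENCY (cell, verbatim): continuum YM on T⁴ ⇐ BetaPertH ∧ nine spine estimates (0/9 proved); BetaPertH ⇐
(D1) ∧ (D4) ∧ CAP+tail; G-an2-4 gates asym, D1 and NE2/3/4.  This file changes none of it.
-/

namespace Summit.QuantumFields.BalabanUV.T4Continuum.SpaceTimePeierls

open Literature.MathematicalPhysics.QuantumFieldTheory.Balaban1983to89
open T4PersistenceDictionary
open Summit.QuantumFields.BalabanUV.T4Continuum.ZoneSkeleton (gmap)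
open Summit.QuantumFields.BalabanUV.T4Continuum.HistoryAdmissible
open Summit.QuantumFields.BalabanUV.T4Continuum.LateMergers (FreshT)

namespace TaggedSanity

/-- **THREE REGIONS JOINED AT ONE STEP** (unit regions born at step `0` at cells `5`, `9`, `12`, joined at step `3` by
two binary joins — print's maximal-tree binarisation of a three-constituent join). [folklore] -/
def threeWay : PGen ℕ := .join (.join (.birth 0 1 5) (.birth 0 1 9) 3) (.birth 0 1 12) 3

/-- … it repeats the join label `(3, 2, 0)` (and the birth label `(0, 0, 1)`): NOT `TypeNodup` (decided) [folklore] -/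
theorem threeWay_not_typeNodup : ¬ threeWay.TypeNodup := by decide

/-- … hence its canonical label is well formed for NO window table (the flat carrier cannot book it) [folklore] -/
theorem threeWay_not_wf (W : PEv → ℕ) : ¬ threeWay.toGen.WF W := PGen.not_wf_toGen threeWay_not_typeNodup W

/-- … while its TAGGED label is fresh [folklore] -/
theorem threeWay_freshT : FreshT (toGenT 0 threeWay) := freshT_toGenT 0 threeWay

/-- … has five events tagged `0 … 4` in pre-order [folklore] -/
example : toGenT 0 threeWay =
    Gen.merge (Gen.merge (Gen.born (2, ((0, 0, 1) : PEv)) 0) (Gen.born (3, ((0, 0, 1) : PEv)) 0) (1, ((3, 2, 0) : PEv)))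
      (Gen.born (4, ((0, 0, 1) : PEv)) 0) (0, ((3, 2, 0) : PEv)) := rfl

/-- … and reads back to the canonical label when the tags are forgotten [folklore] -/
example : gmap Prod.snd (toGenT 0 threeWay) = threeWay.toGen := gmap_snd_toGenT 0 threeWay

/-- the row owner's own excluded example `HistoryAdmissible.PGen.Sanity.twin` (two equal-class regions born at one
step, joined later) has a fresh tagged label too [folklore] -/
theorem twin_freshT : FreshT (toGenT 0 PGen.Sanity.twin) := freshT_toGenT 0 _

/-- … although it is not `TypeNodup` (the owner's decided `twin_not_typeNodup`) [folklore] -/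
example : ¬ PGen.Sanity.twin.TypeNodup := PGen.Sanity.twin_not_typeNodup

end TaggedSanity

end Summit.QuantumFields.BalabanUV.T4Continuum.SpaceTimePeierls
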